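import Literature.Computability.AlgebraicComplexity.BI17QuadraticPeriodProofs
import Literature.Computability.AlgebraicComplexity.BI17QuadraticPolystableProofs
import Literature.Computability.AlgebraicComplexity.BI17NonNormalOrbitClosuresProofs
import HarnessLib

/-!
# The generic reduced stabilizer period of quadratic forms, `a'(2, m) = gcd(2, m)`, and the
# `D = 2` row of BI 2017 Cor. 3.17 (2)

Sibling proof file of `Literature/Computability/AlgebraicComplexity/BI17FundamentalInvariantForms.lean`
(cell `val-lit`, DAG row BI2017-A). From the tree's `BI2017_rem_quadratic_period_holds` ("`a(2,m) = 2`",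
BI 2017 §2.1, remark after Thm. 2.3) and Def. 2.2 (`a'(w) = a(w) gcd(D,m)/D`): almost all quadratic
forms in `m ≥ 1` variables have reduced stabilizer period `gcd(2, m)` (`1` for odd `m`, `2` for even
`m`). Consequence for the bookkeeping of Cor. 3.17 (2) ("`a'(D,m) = 1`, `w` generic, `D` odd or
`gcd(D,m) > 1` ⇒ `\overline{Gw}` not normal"): at `D = 2` the corollary has NO non-vacuous instance —
for even `m` the hypothesis "generically `a'(w) = 1`" is false (`not_isZariskiGeneric_reducedStabilizerPeriod_eq_one_two`,
using `IsZariskiGeneric.exists_form`), for odd `m` the side condition fails (`2` even, `gcd = 1`) —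
consistent with the orbit closure of a nondegenerate quadric being all of `Sym²ℂ^m`, a normal variety.
Everything PROVED; no definitions, no facts; nothing here bears on `VP` versus `VNP`.
-/

noncomputable section

open MvPolynomial

namespace Literature.Computability.AlgebraicComplexity

/-- **`a'(2, m) = gcd(2, m)` generically** (BI 2017 Def. 2.2 applied to `a(2,m) = 2`): almost all
quadratic forms in `m ≥ 1` variables have reduced stabilizer period `gcd(2, m)`.
[cite: BurgisserIkenmeyer2017, Def. 2.2 and §2.1 (remark after Thm. 2.3, "a(2,m) = 2")] -/
theorem isZariskiGeneric_reducedStabilizerPeriod_two {m : ℕ} (hm : 1 ≤ m) :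
    IsZariskiGeneric 2 fun f : MvPolynomial (Fin m) ℂ => reducedStabilizerPeriod 2 f = Nat.gcd 2 m := by
  refine (BI2017_rem_quadratic_period_holds m hm).mono fun f _ hf => ?_
  rw [reducedStabilizerPeriod, hf, Fintype.card_fin, Nat.mul_div_cancel_left _ two_pos]

/-- For EVEN `m ≥ 2` the hypothesis of Cor. 3.17 (2) at `D = 2` fails generically: "almost all
quadrics have `a'(w) = 1`" is false, since almost all have `a'(w) = 2`.
[cite: BurgisserIkenmeyer2017, Cor. 3.17 (2) and Def. 2.2] -/
theorem not_isZariskiGeneric_reducedStabilizerPeriod_eq_one_two {m : ℕ} (hm : 1 ≤ m) (heven : Even m) :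
    ¬ IsZariskiGeneric 2 (fun f : MvPolynomial (Fin m) ℂ => reducedStabilizerPeriod 2 f = 1) := by
  intro h
  obtain ⟨f, -, h1, h2⟩ :=
    IsZariskiGeneric.exists_form (h.and (isZariskiGeneric_reducedStabilizerPeriod_two hm))
  have hgcd : Nat.gcd 2 m = 2 := Nat.gcd_eq_left (even_iff_two_dvd.mp heven)
  rw [h1, hgcd] at h2
  exact absurd h2 (by norm_num)

/-- For ODD `m` the side condition of Cor. 3.17 (2) at `D = 2` fails: `2` is not odd and
`gcd(2, m) = 1`. [cite: BurgisserIkenmeyer2017, Cor. 3.17 (2)] -/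
theorem not_cor_3_17_side_two_of_odd {m : ℕ} (hodd : Odd m) : ¬ (Odd 2 ∨ 1 < Nat.gcd 2 m) := by
  rintro (h | h)
  · exact absurd h (by decide)
  · have : Nat.gcd 2 m = 1 := Nat.coprime_two_left.2 hodd
    omega

end Literature.Computability.AlgebraicComplexity

end
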